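import Summits.QuantumFields.YangMills.Theorems.UnitScaleTiltProp7Growth142T3ChartELCurrent
import HarnessLib

/-!
# Route `UnitScaleTilt`, crux K1 child «MinimiserStabilityRegPr» (stmt-QuantumFields-19200) — `EL_W` IN DERIVATIVE FORM FOR THE EX KNIT v3.0ˢ: the first-variation
# functional `Lin_W` IS the derivative of the Wilson action along every bondwise-differentiable curve, so the knit's E–L CLAUSE at the chart minimiser `W`
# (stationarity along fibre curves) gives `Lin_W(ξ) = 0` on the tangent space of Σ_k (fibre × all gauge transformations)

Cell `ym3-torus`, width seat `ym-ust-19200-w4` (gen 4; ★★OWNER RULING №30 (3): EX re-knit v3.0ˢ displays LOCMIN_W whose premise at the C-min stage is the E–L CLAUSE,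
not `IsCritR2`; the α-P lane supplies «scale-aware Taylor ∧ EL ∧ HESS_W′ ⟹ LOCMIN_W»; this file is the EL junction in that currency, twin of the R2-based
`Prop7Growth142T3ChartEL(Current)`).  THEOREMS ONLY (0 `def`, 0 `sorry`).  YM₃ on T³ is a ladder rung (R3), not the Clay problem; nothing here claims the stub, the crux,
d = 4 or the mass gap.

WHAT IS PROVED (ns `…Theorems.Prop7Growth142T3ChartELStat`; `Lin_W(ξ)` = the letter of `Prop8Criticality.lin_eq_zero_of_isMinOn_of_hasDerivAt`).
§1 ★★ `hasDerivAt_wilsonAction4_of_hasDerivAt_mulStar` — any lattice `T^{(j)}`, `SU(2)`: if `γ 0 = W` and every bond coordinate `t ↦ γ(t)(b)W(b)^*` has derivative `ξ(b)`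
   at `0`, then `t ↦ A(γ t)` has derivative `Lin_W(ξ)` at `0` (the little-o bookkeeping of `Prop8Criticality.lin_eq_zero_of_isMinOn_of_isLittleO` WITHOUT a minimiser:
   two-sided first-order expansion `abs_wilsonAction4_sub_sub_lin_le`, linearity `linPlaq_sub_smul`, `ℓ¹` bound `abs_linPlaq_le`). [Balaban1985Variational] (26)–(27):
   `A(U₁U₀) = A(U₀) + ⟨A, J⟩ + …`.
§2 ★★ `lin_eq_zero_of_fibreEL_of_gaugeLift` — the EX knit's E–L clause at `W` («`deriv (A ∘ φ) 0 = 0` for every curve `φ` in `𝔅_k(V)` through `W`, bondwise differentiable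
   at `0`», the letter of ✓`stubEX_of_chartPiecesTwSR`'s `hGrowth` prefix, VERBATIM) + a curve `γ` through `W` with bond velocities `ξ` and a GAUGE LIFT `u` (`u 0 = 1`,
   `(γ t)^{u t} ∈ 𝔅_k(V)` for all `t`, `t ↦ (γ t)^{u t}` bondwise differentiable at `0`) ⟹ `Lin_W(ξ) = 0`: (141) on the tangent space of Σ_k from STATIONARITY (gauge
   invariance of (5) makes `A ∘ γ = A ∘ (γ^u)`; §1 identifies the derivative).
§3 ★ `abs_lin_chart_le_of_fibreEL_current` — with `DivSmall F n K e W`: `|ℓ_W(D)| ≤ e·(L^{K−n})⁻³·Σ_b‖iD(b) − ξ(b)‖` for every such `(γ, u, ξ)` — the EX-side twin of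
   `Prop7Growth142T3ChartELCurrent.abs_lin_chart_le_of_sigmaVelocity_current`.

HONEST SCOPE.  Carrier-side calculus; the gauge lift's differentiability is a HYPOTHESIS (print: the (1.29)-normalised `u` of [Balaban1985RegularSpaces] Thm 2 is an explicit
function of the configuration, (106) of [5]); nothing of print asserted; `--supports stmt-QuantumFields-19200`, count-neutral.

References: T. Bałaban, CMP 102 (1985) 277–309 [Balaban1985Variational] ((26)–(27) p.282, (127) p.297, (141) p.299); CMP 99 (1985) 75–102 [Balaban1985RegularSpaces] ((1.28)–(1.31) pp.80–82).
-/

set_option autoImplicit false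
noncomputable section

open scoped BigOperators Matrix.Norms.L2Operator Matrix Topology
open Filter Asymptotics

namespace Summit.QuantumFields.YangMills.Theorems.Prop7Growth142T3ChartELStat

open Literature.MathematicalPhysics.QuantumFieldTheory.Balaban1983to89
open Literature.MathematicalPhysics.QuantumFieldTheory.Balaban1983to89.T3ContinuumYM3Torus
open Literature.MathematicalPhysics.QuantumFieldTheory.Balaban1983to89.T3UnitLawDensityEML (ℰp)
open Literature.MathematicalPhysics.QuantumFieldTheory.Balaban1983to89.T3ConstrainedMinimiser
open Literature.MathematicalPhysics.QuantumFieldTheory.Balaban1983to89.T3Thm1Carrier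
open Literature.MathematicalPhysics.QuantumFieldTheory.Balaban1983to89.T3PrintedRegularMinimiser
open Literature.MathematicalPhysics.QuantumFieldTheory.Balaban1983to89.T3RegularMinimiser
open Summit.QuantumFields.YangMills.Theorems.Prop8Criticality (abs_wilsonAction4_sub_sub_lin_le linPlaq_sub_smul abs_linPlaq_le norm_coe_sub_one_le_two)
open Summit.QuantumFields.YangMills.Theorems.Prop7FlatLocalMin (sum_plaq_bonds_le)
open Summit.QuantumFields.YangMills.Theorems.Prop7Growth142T3ChartELCurrent (abs_lin_sub_lin_le_of_divSmall)

/-! ## §1 `Lin_W` is the derivative of the action along bondwise-differentiable curves -/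

section Deriv

variable {P : Params} {j : ℕ}

set_option maxHeartbeats 400000 in
/-- ★★ **`Lin_W` IS THE DERIVATIVE**: if `γ 0 = W` and every bond coordinate `t ↦ γ(t)(b)·W(b)^*` has derivative `ξ(b)` at `0`, then `t ↦ A(γ t)` has derivative
`Lin_W(ξ)` at `0`. [cite: Balaban1985Variational, (26)-(27) p.282, (127) p.297] -/
theorem hasDerivAt_wilsonAction4_of_hasDerivAt_mulStar (W : GaugeField P j (Matrix.specialUnitaryGroup (Fin 2) ℂ))
    (γ : ℝ → GaugeField P j (Matrix.specialUnitaryGroup (Fin 2) ℂ)) (hγ0 : γ 0 = W) (ξ : PBond P j → Matrix (Fin 2) (Fin 2) ℂ)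
    (hγξ : ∀ b : PBond P j, HasDerivAt (fun t : ℝ => (γ t b : Matrix (Fin 2) (Fin 2) ℂ) * star (W b : Matrix (Fin 2) (Fin 2) ℂ)) (ξ b) 0) :
    HasDerivAt (fun t : ℝ => wilsonAction4 (γ t))
      (∑ p : Plaq P j, (1 / 2) * ((((((GaugeField.plaqHol W p : Matrix.specialUnitaryGroup (Fin 2) ℂ) : Matrix (Fin 2) (Fin 2) ℂ)) - 1)ᴴ
          * ((ξ ⟨p.src, p.μ⟩
              + (W ⟨p.src, p.μ⟩ : Matrix (Fin 2) (Fin 2) ℂ) * ξ ⟨p.src.shift p.μ, p.ν⟩ * star (W ⟨p.src, p.μ⟩ : Matrix (Fin 2) (Fin 2) ℂ)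
              - ((W ⟨p.src, p.μ⟩ * W ⟨p.src.shift p.μ, p.ν⟩ * (W ⟨p.src.shift p.ν, p.μ⟩)⁻¹ : Matrix.specialUnitaryGroup (Fin 2) ℂ) : Matrix (Fin 2) (Fin 2) ℂ)
                  * ξ ⟨p.src.shift p.ν, p.μ⟩
                  * star ((W ⟨p.src, p.μ⟩ * W ⟨p.src.shift p.μ, p.ν⟩ * (W ⟨p.src.shift p.ν, p.μ⟩)⁻¹ : Matrix.specialUnitaryGroup (Fin 2) ℂ) : Matrix (Fin 2) (Fin 2) ℂ)
              - ((GaugeField.plaqHol W p : Matrix.specialUnitaryGroup (Fin 2) ℂ) : Matrix (Fin 2) (Fin 2) ℂ) * ξ ⟨p.src, p.ν⟩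
                  * star ((GaugeField.plaqHol W p : Matrix.specialUnitaryGroup (Fin 2) ℂ) : Matrix (Fin 2) (Fin 2) ℂ))
            * ((GaugeField.plaqHol W p : Matrix.specialUnitaryGroup (Fin 2) ℂ) : Matrix (Fin 2) (Fin 2) ℂ))).trace).re) 0 := by
  -- the first variation as a function of the bond field
  set Λ : (PBond P j → Matrix (Fin 2) (Fin 2) ℂ) → ℝ := fun Z =>
    ∑ p : Plaq P j, (1 / 2) * ((((((GaugeField.plaqHol W p : Matrix.specialUnitaryGroup (Fin 2) ℂ) : Matrix (Fin 2) (Fin 2) ℂ)) - 1)ᴴ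
          * ((Z ⟨p.src, p.μ⟩
              + (W ⟨p.src, p.μ⟩ : Matrix (Fin 2) (Fin 2) ℂ) * Z ⟨p.src.shift p.μ, p.ν⟩ * star (W ⟨p.src, p.μ⟩ : Matrix (Fin 2) (Fin 2) ℂ)
              - ((W ⟨p.src, p.μ⟩ * W ⟨p.src.shift p.μ, p.ν⟩ * (W ⟨p.src.shift p.ν, p.μ⟩)⁻¹ : Matrix.specialUnitaryGroup (Fin 2) ℂ) : Matrix (Fin 2) (Fin 2) ℂ)
                  * Z ⟨p.src.shift p.ν, p.μ⟩
                  * star ((W ⟨p.src, p.μ⟩ * W ⟨p.src.shift p.μ, p.ν⟩ * (W ⟨p.src.shift p.ν, p.μ⟩)⁻¹ : Matrix.specialUnitaryGroup (Fin 2) ℂ) : Matrix (Fin 2) (Fin 2) ℂ)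
              - ((GaugeField.plaqHol W p : Matrix.specialUnitaryGroup (Fin 2) ℂ) : Matrix (Fin 2) (Fin 2) ℂ) * Z ⟨p.src, p.ν⟩
                  * star ((GaugeField.plaqHol W p : Matrix.specialUnitaryGroup (Fin 2) ℂ) : Matrix (Fin 2) (Fin 2) ℂ))
            * ((GaugeField.plaqHol W p : Matrix.specialUnitaryGroup (Fin 2) ℂ) : Matrix (Fin 2) (Fin 2) ℂ))).trace).re with hΛ
  set Y : ℝ → PBond P j → Matrix (Fin 2) (Fin 2) ℂ := fun t b => (γ t b : Matrix (Fin 2) (Fin 2) ℂ) * star (W b : Matrix (Fin 2) (Fin 2) ℂ) - 1 with hY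
  set Mξ : ℝ := ∑ b : PBond P j, ‖ξ b‖ with hM
  set B : ℝ := (Fintype.card (PBond P j) : ℝ) with hB
  set Dd : ℝ := (P.d : ℝ) with hD
  have hM0 : 0 ≤ Mξ := Finset.sum_nonneg fun b _ => norm_nonneg _
  have hB0 : 0 ≤ B := Nat.cast_nonneg _
  have hD0 : 0 ≤ Dd := Nat.cast_nonneg _
  have hMb : ∀ b : PBond P j, ‖ξ b‖ ≤ Mξ := fun b =>
    Finset.single_le_sum (f := fun b => ‖ξ b‖) (fun b _ => norm_nonneg _) (Finset.mem_univ b)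
  -- (1) linearity and the `ℓ¹` bound of `Λ`
  have hlin : ∀ t : ℝ, Λ (Y t) - t * Λ ξ = Λ (fun b => Y t b - (t : ℂ) • ξ b) := by
    intro t
    simp only [hΛ, Finset.mul_sum, ← Finset.sum_sub_distrib]
    exact Finset.sum_congr rfl fun p _ => linPlaq_sub_smul W (Y t) ξ t p
  have hΛle : ∀ Z : PBond P j → Matrix (Fin 2) (Fin 2) ℂ, |Λ Z| ≤ 2 * (4 * Dd) * ∑ b : PBond P j, ‖Z b‖ := by
    intro Z
    simp only [hΛ]
    refine (Finset.abs_sum_le_sum_abs _ _).trans ?_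
    have hper : ∀ p : Plaq P j, _ ≤ 2 * (‖Z ⟨p.src, p.μ⟩‖ + ‖Z ⟨p.src.shift p.μ, p.ν⟩‖ + ‖Z ⟨p.src.shift p.ν, p.μ⟩‖ + ‖Z ⟨p.src, p.ν⟩‖) :=
      fun p => (abs_linPlaq_le W Z p).trans (mul_le_mul_of_nonneg_right (norm_coe_sub_one_le_two _) (by positivity))
    refine (Finset.sum_le_sum fun p _ => hper p).trans ?_
    rw [← Finset.mul_sum, mul_assoc]
    exact mul_le_mul_of_nonneg_left (sum_plaq_bonds_le (fun b => ‖Z b‖) fun b => norm_nonneg _) zero_le_two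
  -- (2) little-o: for every `c > 0`, eventually `|A(γ t) − A(W) − t·Λ ξ| ≤ c|t|`
  rw [hasDerivAt_iff_isLittleO_nhds_zero]
  refine Asymptotics.isLittleO_iff.mpr fun c hc => ?_
  set ε : ℝ := c / 2 / (2 * (4 * Dd) * B + 1) with hε
  have hεpos : 0 < ε := by positivity
  have hεslack : 2 * (4 * Dd) * B * ε ≤ c / 2 := by
    have h1 : 2 * (4 * Dd) * B * ε ≤ (2 * (4 * Dd) * B + 1) * ε := mul_le_mul_of_nonneg_right (le_add_of_nonneg_right zero_le_one) hεpos.le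
    rw [hε, mul_div_cancel₀ _ (by positivity : (2 : ℝ) * (4 * Dd) * B + 1 ≠ 0)] at h1
    exact h1
  -- bondwise little-o from the bond derivatives
  have hdef : ∀ᶠ t in 𝓝 (0 : ℝ), ∀ b : PBond P j, ‖Y t b - (t : ℂ) • ξ b‖ ≤ ε * |t| := by
    refine Filter.eventually_all.mpr fun b => ?_
    have h1 := (hasDerivAt_iff_isLittleO_nhds_zero.mp (hγξ b)).def hεpos
    have h0 : (γ 0 b : Matrix (Fin 2) (Fin 2) ℂ) * star (W b : Matrix (Fin 2) (Fin 2) ℂ) = 1 := by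
      rw [hγ0]; exact Matrix.mem_unitaryGroup_iff.mp (W b).2.1
    filter_upwards [h1] with t ht
    rw [zero_add, h0, Real.norm_eq_abs] at ht
    rwa [hY, Complex.coe_smul]
  -- the window: fluctuations `≤ |t|(M + ε) ≤ 1/4` and the quadratic term `≤ (c/2)|t|`
  set K₂ : ℝ := (8 * 2 + 18) * (4 * Dd) * (B * (Mξ + ε) ^ 2) with hK₂
  have hK₂0 : 0 ≤ K₂ := by positivity
  set t₁ : ℝ := min (1 / (4 * (Mξ + ε) + 1)) (c / 2 / (K₂ + 1)) with ht₁
  have ht₁pos : 0 < t₁ := lt_min (by positivity) (by positivity)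
  have hwin : t₁ * (Mξ + ε) ≤ 1 / 4 := by
    have hle : t₁ ≤ 1 / (4 * (Mξ + ε) + 1) := min_le_left _ _
    have h1 : 1 / (4 * (Mξ + ε) + 1) * (4 * (Mξ + ε) + 1) = 1 := by rw [div_mul_cancel₀ _ (by positivity : (4 : ℝ) * (Mξ + ε) + 1 ≠ 0)]
    nlinarith [hle, h1, hM0, hεpos.le, ht₁pos]
  have hquad : K₂ * t₁ ≤ c / 2 := by
    have hle : t₁ ≤ c / 2 / (K₂ + 1) := min_le_right _ _
    have h1 : c / 2 / (K₂ + 1) * (K₂ + 1) = c / 2 := div_mul_cancel₀ _ (by positivity : K₂ + 1 ≠ 0)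
    nlinarith [hle, h1, hK₂0, hc.le]
  have hsmall : ∀ᶠ t in 𝓝 (0 : ℝ), |t| < t₁ := by
    have := Metric.ball_mem_nhds (0 : ℝ) ht₁pos
    filter_upwards [this] with t ht
    rwa [Metric.mem_ball, Real.dist_eq, sub_zero] at ht
  filter_upwards [hdef, hsmall] with t hZ htt₁
  -- bond fluctuations
  have hYb : ∀ b : PBond P j, ‖Y t b‖ ≤ |t| * (Mξ + ε) := by
    intro b
    have h1 := hZ b
    have h2 : ‖(t : ℂ) • ξ b‖ = |t| * ‖ξ b‖ := by rw [norm_smul, Complex.norm_real, Real.norm_eq_abs]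
    have h3 : ‖Y t b‖ ≤ ‖(t : ℂ) • ξ b‖ + ‖Y t b - (t : ℂ) • ξ b‖ := by
      have := norm_add_le ((t : ℂ) • ξ b) (Y t b - (t : ℂ) • ξ b); rwa [add_sub_cancel] at this
    have h6 : |t| * ‖ξ b‖ ≤ |t| * Mξ := mul_le_mul_of_nonneg_left (hMb b) (abs_nonneg t)
    calc ‖Y t b‖ ≤ ‖(t : ℂ) • ξ b‖ + ‖Y t b - (t : ℂ) • ξ b‖ := h3
      _ ≤ |t| * Mξ + ε * |t| := by rw [h2]; exact add_le_add h6 h1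
      _ = |t| * (Mξ + ε) := by ring
  have hδ : ∀ b : PBond P j, ‖(γ t b : Matrix (Fin 2) (Fin 2) ℂ) * star (W b : Matrix (Fin 2) (Fin 2) ℂ) - 1‖ ≤ |t| * (Mξ + ε) := hYb
  have hδ4 : |t| * (Mξ + ε) ≤ 1 / 4 := (mul_le_mul_of_nonneg_right htt₁.le (by positivity)).trans hwin
  have h2 := abs_wilsonAction4_sub_sub_lin_le (γ t) W zero_le_two (fun p => norm_coe_sub_one_le_two _) hδ hδ4
  change |wilsonAction4 (γ t) - wilsonAction4 W - Λ (Y t)| ≤ (8 * 2 + 18) * (4 * P.d) * ∑ b : PBond P j, ‖Y t b‖ ^ 2 at h2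
  have hs1 : ∑ b : PBond P j, ‖Y t b‖ ^ 2 ≤ B * (|t| * (Mξ + ε)) ^ 2 := by
    calc ∑ b : PBond P j, ‖Y t b‖ ^ 2 ≤ ∑ _b : PBond P j, (|t| * (Mξ + ε)) ^ 2 :=
          Finset.sum_le_sum fun b _ => pow_le_pow_left₀ (norm_nonneg _) (hYb b) 2
      _ = B * (|t| * (Mξ + ε)) ^ 2 := by rw [Finset.sum_const, Finset.card_univ, nsmul_eq_mul]
  have hs2 : ∑ b : PBond P j, ‖Y t b - (t : ℂ) • ξ b‖ ≤ B * (ε * |t|) := by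
    calc ∑ b : PBond P j, ‖Y t b - (t : ℂ) • ξ b‖ ≤ ∑ _b : PBond P j, ε * |t| := Finset.sum_le_sum fun b _ => hZ b
      _ = B * (ε * |t|) := by rw [Finset.sum_const, Finset.card_univ, nsmul_eq_mul]
  have h3 := hΛle (fun b => Y t b - (t : ℂ) • ξ b)
  rw [← hlin t] at h3
  -- assemble: `‖A(γ t) − A(γ 0) − t • Λ ξ‖ ≤ c‖t‖`
  have hγ0W : wilsonAction4 (γ 0) = wilsonAction4 W := by rw [hγ0]
  rw [zero_add, hγ0W, smul_eq_mul, Real.norm_eq_abs, Real.norm_eq_abs]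
  have hsplit : wilsonAction4 (γ t) - wilsonAction4 W - t * Λ ξ
      = (wilsonAction4 (γ t) - wilsonAction4 W - Λ (Y t)) + (Λ (Y t) - t * Λ ξ) := by ring
  rw [hsplit]
  refine (abs_add_le _ _).trans ?_
  have ht2 : (|t| * (Mξ + ε)) ^ 2 = (Mξ + ε) ^ 2 * (|t| * |t|) := by ring
  have e1 : (8 * 2 + 18) * (4 * (P.d : ℝ)) * ∑ b : PBond P j, ‖Y t b‖ ^ 2 ≤ K₂ * |t| * |t| := by
    have := mul_le_mul_of_nonneg_left hs1 (show (0 : ℝ) ≤ (8 * 2 + 18) * (4 * (P.d : ℝ)) by positivity)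
    rw [ht2] at this
    have hK : (8 * 2 + 18) * (4 * (P.d : ℝ)) * (B * ((Mξ + ε) ^ 2 * (|t| * |t|))) = K₂ * |t| * |t| := by rw [hK₂, hD]; ring
    linarith [this, hK.le, hK.ge]
  have e1' : K₂ * |t| * |t| ≤ c / 2 * |t| := by
    have := mul_le_mul_of_nonneg_right (show K₂ * |t| ≤ c / 2 from (mul_le_mul_of_nonneg_left htt₁.le hK₂0).trans hquad) (abs_nonneg t)
    exact this
  have e2 : 2 * (4 * Dd) * ∑ b : PBond P j, ‖Y t b - (t : ℂ) • ξ b‖ ≤ c / 2 * |t| := by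
    have := mul_le_mul_of_nonneg_left hs2 (show (0 : ℝ) ≤ 2 * (4 * Dd) by positivity)
    have h' : 2 * (4 * Dd) * (B * (ε * |t|)) = (2 * (4 * Dd) * B * ε) * |t| := by ring
    rw [h'] at this
    exact this.trans (mul_le_mul_of_nonneg_right hεslack (abs_nonneg t))
  linarith [h2, h3, e1, e1', e2]

end Deriv

/-! ## §2 The E–L clause at `W` (stationarity along fibre curves) ⟹ `Lin_W = 0` on the tangent space of Σ_k -/

section Stat

variable {F : T3Family} {n K : ℕ} {h : n ≤ K}

/-- ★★ **STATIONARITY ⇒ (141) ON THE TANGENT SPACE OF Σ_k.**  Let `W` satisfy the EX knit's E–L clause (the derivative of the action vanishes along every curve in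
`𝔅_k(V)` through `W` that is bondwise differentiable at `0`).  Let `γ` be a curve through `W` with bond velocities `ξ` (derivatives of `γ(t)(b)W(b)^*`), admitting a
GAUGE LIFT `u` into the fibre (`u 0 = 1`, `(γ t)^{u t} ∈ 𝔅_k(V)`, `t ↦ (γ t)^{u t}` bondwise differentiable at `0`).  Then `Lin_W(ξ) = 0`: the action is gauge invariant,
so `A ∘ γ = A ∘ γ^u`, whose derivative at `0` vanishes by stationarity, while §1 identifies it with `Lin_W(ξ)`.
[cite: Balaban1985Variational, (141) p.299, (4)-(5) p.278; Balaban1985RegularSpaces, (1.28)-(1.30) p.81] -/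
theorem lin_eq_zero_of_fibreEL_of_gaugeLift {V : GaugeField (F.P n) 0 (Matrix.specialUnitaryGroup (Fin 2) ℂ)} {W : GaugeField (F.P K) 0 (Matrix.specialUnitaryGroup (Fin 2) ℂ)}
    (hEL : ∀ φ : ℝ → GaugeField (F.P K) 0 (Matrix.specialUnitaryGroup (Fin 2) ℂ), φ 0 = W → (∀ t, φ t ∈ fibre F ℰp n K h V) →
      (∀ b : PBond (F.P K) 0, DifferentiableAt ℝ (fun t => ((φ t b : Matrix.specialUnitaryGroup (Fin 2) ℂ) : Matrix (Fin 2) (Fin 2) ℂ)) 0) →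
        deriv (fun t => wilsonAction4 (φ t)) 0 = 0)
    (γ : ℝ → GaugeField (F.P K) 0 (Matrix.specialUnitaryGroup (Fin 2) ℂ)) (hγ0 : γ 0 = W)
    (ξ : PBond (F.P K) 0 → Matrix (Fin 2) (Fin 2) ℂ)
    (hγξ : ∀ b : PBond (F.P K) 0, HasDerivAt (fun t : ℝ => (γ t b : Matrix (Fin 2) (Fin 2) ℂ) * star (W b : Matrix (Fin 2) (Fin 2) ℂ)) (ξ b) 0)
    (u : ℝ → GaugeTransf (F.P K) 0 (Matrix.specialUnitaryGroup (Fin 2) ℂ)) (hu0 : u 0 = fun _ => 1)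
    (hufib : ∀ t, GaugeField.gaugeAct (u t) (γ t) ∈ fibre F ℰp n K h V)
    (hudiff : ∀ b : PBond (F.P K) 0, DifferentiableAt ℝ (fun t => ((GaugeField.gaugeAct (u t) (γ t) b : Matrix.specialUnitaryGroup (Fin 2) ℂ) : Matrix (Fin 2) (Fin 2) ℂ)) 0) :
    ∑ p : Plaq (F.P K) 0, (1 / 2) * ((((((GaugeField.plaqHol W p : Matrix.specialUnitaryGroup (Fin 2) ℂ) : Matrix (Fin 2) (Fin 2) ℂ)) - 1)ᴴ
          * ((ξ ⟨p.src, p.μ⟩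
              + (W ⟨p.src, p.μ⟩ : Matrix (Fin 2) (Fin 2) ℂ) * ξ ⟨p.src.shift p.μ, p.ν⟩ * star (W ⟨p.src, p.μ⟩ : Matrix (Fin 2) (Fin 2) ℂ)
              - ((W ⟨p.src, p.μ⟩ * W ⟨p.src.shift p.μ, p.ν⟩ * (W ⟨p.src.shift p.ν, p.μ⟩)⁻¹ : Matrix.specialUnitaryGroup (Fin 2) ℂ) : Matrix (Fin 2) (Fin 2) ℂ)
                  * ξ ⟨p.src.shift p.ν, p.μ⟩
                  * star ((W ⟨p.src, p.μ⟩ * W ⟨p.src.shift p.μ, p.ν⟩ * (W ⟨p.src.shift p.ν, p.μ⟩)⁻¹ : Matrix.specialUnitaryGroup (Fin 2) ℂ) : Matrix (Fin 2) (Fin 2) ℂ)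
              - ((GaugeField.plaqHol W p : Matrix.specialUnitaryGroup (Fin 2) ℂ) : Matrix (Fin 2) (Fin 2) ℂ) * ξ ⟨p.src, p.ν⟩
                  * star ((GaugeField.plaqHol W p : Matrix.specialUnitaryGroup (Fin 2) ℂ) : Matrix (Fin 2) (Fin 2) ℂ))
            * ((GaugeField.plaqHol W p : Matrix.specialUnitaryGroup (Fin 2) ℂ) : Matrix (Fin 2) (Fin 2) ℂ))).trace).re = 0 := by
  have hD := hasDerivAt_wilsonAction4_of_hasDerivAt_mulStar W γ hγ0 ξ hγξ
  have hfun : (fun t : ℝ => wilsonAction4 (γ t)) = fun t : ℝ => wilsonAction4 (GaugeField.gaugeAct (u t) (γ t)) :=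
    funext fun t => (T4WilsonGaugeFlatDirection.wilsonAction_gaugeAct 1 (u t) (γ t)).symm
  have hφ0 : GaugeField.gaugeAct (u 0) (γ 0) = W := by
    rw [hu0, hγ0]
    funext b
    simp [GaugeField.gaugeAct]
  have h0 := hEL (fun t => GaugeField.gaugeAct (u t) (γ t)) hφ0 hufib hudiff
  rw [← hfun, hD.deriv] at h0
  exact h0

/-- ★ **`EL_W` FOR A GENERAL CHART COMPETITOR FROM STATIONARITY, AT THE CURRENT RATE**: with the divergence clause `DivSmall F n K e W` of (2) at `W`, for a
Hermitian-traceless `D` and any `(γ, ξ, u)` as above, `|ℓ_W(D)| ≤ e·(L^{K−n})⁻³·Σ_b‖iD(b) − ξ(b)‖`. [cite: Balaban1985Variational, (141) p.299, (6) p.278, (47)-(48) pp.285-286] -/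
theorem abs_lin_chart_le_of_fibreEL_current {V : GaugeField (F.P n) 0 (Matrix.specialUnitaryGroup (Fin 2) ℂ)} {W : GaugeField (F.P K) 0 (Matrix.specialUnitaryGroup (Fin 2) ℂ)}
    (hEL : ∀ φ : ℝ → GaugeField (F.P K) 0 (Matrix.specialUnitaryGroup (Fin 2) ℂ), φ 0 = W → (∀ t, φ t ∈ fibre F ℰp n K h V) →
      (∀ b : PBond (F.P K) 0, DifferentiableAt ℝ (fun t => ((φ t b : Matrix.specialUnitaryGroup (Fin 2) ℂ) : Matrix (Fin 2) (Fin 2) ℂ)) 0) →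
        deriv (fun t => wilsonAction4 (φ t)) 0 = 0)
    {e : ℝ} (hWdiv : DivSmall F n K e W) (D : PBond (F.P K) 0 → Matrix (Fin 2) (Fin 2) ℂ)
    (γ : ℝ → GaugeField (F.P K) 0 (Matrix.specialUnitaryGroup (Fin 2) ℂ)) (hγ0 : γ 0 = W)
    (ξ : PBond (F.P K) 0 → Matrix (Fin 2) (Fin 2) ℂ)
    (hγξ : ∀ b : PBond (F.P K) 0, HasDerivAt (fun t : ℝ => (γ t b : Matrix (Fin 2) (Fin 2) ℂ) * star (W b : Matrix (Fin 2) (Fin 2) ℂ)) (ξ b) 0)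
    (u : ℝ → GaugeTransf (F.P K) 0 (Matrix.specialUnitaryGroup (Fin 2) ℂ)) (hu0 : u 0 = fun _ => 1)
    (hufib : ∀ t, GaugeField.gaugeAct (u t) (γ t) ∈ fibre F ℰp n K h V)
    (hudiff : ∀ b : PBond (F.P K) 0, DifferentiableAt ℝ (fun t => ((GaugeField.gaugeAct (u t) (γ t) b : Matrix.specialUnitaryGroup (Fin 2) ℂ) : Matrix (Fin 2) (Fin 2) ℂ)) 0) :
    |∑ p : Plaq (F.P K) 0, (1 / 2) * (((((GaugeField.plaqHol W p : Matrix.specialUnitaryGroup (Fin 2) ℂ) : Matrix (Fin 2) (Fin 2) ℂ) - 1)ᴴ * (((Complex.I • D ⟨p.src, p.μ⟩) + ((W ⟨p.src, p.μ⟩ : Matrix (Fin 2) (Fin 2) ℂ) * (Complex.I • D ⟨p.src.shift p.μ, p.ν⟩) * star (W ⟨p.src, p.μ⟩ : Matrix (Fin 2) (Fin 2) ℂ))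
            - (((W ⟨p.src, p.μ⟩ * W ⟨p.src.shift p.μ, p.ν⟩ * (W ⟨p.src.shift p.ν, p.μ⟩)⁻¹ : Matrix.specialUnitaryGroup (Fin 2) ℂ) : Matrix (Fin 2) (Fin 2) ℂ) * (Complex.I • D ⟨p.src.shift p.ν, p.μ⟩) * star ((W ⟨p.src, p.μ⟩ * W ⟨p.src.shift p.μ, p.ν⟩ * (W ⟨p.src.shift p.ν, p.μ⟩)⁻¹ : Matrix.specialUnitaryGroup (Fin 2) ℂ) : Matrix (Fin 2) (Fin 2) ℂ))
            - (((GaugeField.plaqHol W p : Matrix.specialUnitaryGroup (Fin 2) ℂ) : Matrix (Fin 2) (Fin 2) ℂ) * (Complex.I • D ⟨p.src, p.ν⟩) * star ((GaugeField.plaqHol W p : Matrix.specialUnitaryGroup (Fin 2) ℂ) : Matrix (Fin 2) (Fin 2) ℂ))) * ((GaugeField.plaqHol W p : Matrix.specialUnitaryGroup (Fin 2) ℂ) : Matrix (Fin 2) (Fin 2) ℂ))).trace).re|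
      ≤ e * (((F.L : ℝ) ^ (K - n)) ^ 3)⁻¹ * ∑ b : PBond (F.P K) 0, ‖Complex.I • D b - ξ b‖ := by
  have h0 := lin_eq_zero_of_fibreEL_of_gaugeLift hEL γ hγ0 ξ hγξ u hu0 hufib hudiff
  have h1 := abs_lin_sub_lin_le_of_divSmall W hWdiv (fun b => Complex.I • D b) ξ
  simpa only [h0, sub_zero] using h1

end Stat

end Summit.QuantumFields.YangMills.Theorems.Prop7Growth142T3ChartELStat

end
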